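import Mathlib
import HarnessLib
import HarnessLib.Audit.Tags

/-!
# HodgeLocusCensusFrickeSquare — the algebraic identities behind the square-class law of CELL V3-XT-W (cell pub-hlocus, abs-1 gen 14)
HONEST FRAMING: certified instances and evidence bearing on the general Hodge conjecture; no claim.

CELL V3-XT-W (`ABSHODGE.md #### V3-XT-W`, derivation `code/abs_engineA/xt/xtw/DERIVATION-XTW.md`) explains the law found by the exact
layer XT-S of V3-XT (`HodgeLocusCensusTateSignAnchors`, `…Anchors2`): at a CM fibre `X₀` of the quartic / ci23 / ci222 K3 pencil
(`N = 2, 3, 4`), which of `α₀ = X₀(X₀ − C)` and `D₀α₀` is a square in `F = ℚ(X₀)`.  The pencil parameter is `X = (u + c₀)²/u` in the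
Hauptmodul `u = (η(τ)/η(Nτ))^e` of `Γ₀(N)` (`e = 24, 12, 8`, `c₀ = N^{e/4} = 64, 27, 16`, `C = 4c₀ = 256, 108, 64`), and the Fricke
involution acts by `u ↦ u* = c₀²/u`.  The whole Galois analysis rests on three pieces of pure algebra, kernel-checked here over an
arbitrary field:
* `X` is Fricke-invariant: `X(u*) = X(u)` (`fricke_invariant`), so `ℚ(X) ⊆ ℚ(u)^{w_N}` and `u, u*` are the two preimages of `X`;
* `u` is quadratic over `ℚ(X)`: `u² − (X − 2c₀)u + c₀² = 0` (`u_quadratic`), with discriminant `(X − 2c₀)² − 4c₀² = X(X − C)` (`disc_eq_alpha`);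
* hence `α = X(X − C) = (u − u*)²` is ALWAYS a square in `ℚ(u)` (`alpha_eq_sq_sub_fricke`), and `ℚ(u) = ℚ(X)(√α)`.
Given these, `α₀ ∈ F²` iff `ℚ(u₀) = F`, and `D₀α₀ ∈ F²` iff `F(√α₀) = F(√D₀)`; which case occurs is decided by whether complex conjugation and
`w_N` preserve the `Aut(ℂ/K)`-orbit of the CM point on `X₀(N)` (Shimura reciprocity) — decided exactly per orbit by lattice arithmetic and
re-decided independently on the value side (716/716 orbits, `data/abs/xt/XTW-LAW.tsv`); that part is the cited two-implementation evidence,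
not a Lean theorem.  The last lemma records the constants: `c₀² = N^{e/2}` (the constant in `u(w_Nτ)·u(τ) = N^{e/2}` from
`η(−1/τ)² = −iτ·η(τ)²`) and `C = 4c₀` for the three pencils.
-/

namespace Summit.HodgeConjecture.HodgeConjecture.HodgeLocus.Census.FrickeSquare

variable {K : Type*} [Field K]

/-- The pencil parameter as a function of the Hauptmodul value: `X(u) = (u + c₀)²/u`. -/
def X (c₀ u : K) : K := (u + c₀) ^ 2 / u

/-- Fricke invariance: `X(c₀²/u) = X(u)` for `u ≠ 0`, `c₀ ≠ 0`. -/
theorem fricke_invariant (c₀ u : K) (hu : u ≠ 0) (hc : c₀ ≠ 0) : X c₀ (c₀ ^ 2 / u) = X c₀ u := by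
  unfold X
  field_simp
  ring

/-- `u` is a root of `T² − (X − 2c₀)T + c₀²` over `ℚ(X)`. -/
theorem u_quadratic (c₀ u : K) (hu : u ≠ 0) : u ^ 2 - (X c₀ u - 2 * c₀) * u + c₀ ^ 2 = 0 := by
  unfold X
  field_simp
  ring

/-- The other root of that quadratic is the Fricke image `u* = c₀²/u` (Vieta: `u + u* = X − 2c₀`, `u·u* = c₀²`). -/
theorem vieta (c₀ u : K) (hu : u ≠ 0) : u + c₀ ^ 2 / u = X c₀ u - 2 * c₀ ∧ u * (c₀ ^ 2 / u) = c₀ ^ 2 := by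
  unfold X
  constructor
  · field_simp
    ring
  · field_simp

/-- The discriminant of `T² − (X − 2c₀)T + c₀²` is `α = X(X − C)` with `C = 4c₀` (valid in any commutative ring). -/
theorem disc_eq_alpha {R : Type*} [CommRing R] (c₀ x : R) : (x - 2 * c₀) ^ 2 - 4 * c₀ ^ 2 = x * (x - 4 * c₀) := by ring

/-- THE SQUARE IDENTITY: `α = X(X − C) = (u − u*)²` with `u* = c₀²/u`; so `√α₀ = ±(u₀ − u₀*) ∈ ℚ(u₀)` at every fibre. -/
theorem alpha_eq_sq_sub_fricke (c₀ u : K) (hu : u ≠ 0) :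
    X c₀ u * (X c₀ u - 4 * c₀) = (u - c₀ ^ 2 / u) ^ 2 := by
  unfold X
  field_simp
  ring

/-- Equivalent polynomial form used by XT-S: `X − C = (u − c₀)²/u`, hence `X(X − C) = ((u² − c₀²)/u)²`. -/
theorem X_sub_C (c₀ u : K) (hu : u ≠ 0) : X c₀ u - 4 * c₀ = (u - c₀) ^ 2 / u ∧ X c₀ u * (X c₀ u - 4 * c₀) = ((u ^ 2 - c₀ ^ 2) / u) ^ 2 := by
  unfold X
  constructor
  · field_simp
    ring
  · field_simp
    ring

/-- If `w_N` fixes the point, i.e. `u* = u`, then `u = ±c₀` and `X ∈ {C, 0}` (a singular fibre) — so `w_N` acts freely on CM orbits. -/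
theorem fricke_fixed_iff (c₀ u : K) (hu : u ≠ 0) : c₀ ^ 2 / u = u ↔ (u = c₀ ∨ u = -c₀) := by
  constructor
  · intro h
    have h2 : u ^ 2 = c₀ ^ 2 := by
      have := h
      field_simp at this
      linear_combination -this
    have : (u - c₀) * (u + c₀) = 0 := by ring_nf; linear_combination h2
    rcases mul_eq_zero.mp this with h3 | h3
    · left; linear_combination h3
    · right; linear_combination h3
  · rintro (rfl | rfl)
    · field_simp
    · field_simp

/-- The values of `X` at the two Fricke-fixed points `u = ±c₀`: `X = C = 4c₀` and `X = 0` (the singular fibres of the pencil). -/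
theorem X_at_fricke_fixed (c₀ : K) (hc : c₀ ≠ 0) : X c₀ c₀ = 4 * c₀ ∧ X c₀ (-c₀) = 0 := by
  unfold X
  constructor
  · field_simp
    ring
  · have : (-c₀ + c₀) = (0 : K) := by ring
    rw [this]
    simp

/-- The constants of the three pencils: `(N, e, c₀, C)` = `(2,24,64,256)`, `(3,12,27,108)`, `(4,8,16,64)` satisfy `c₀ = N^{e/4}`,
`c₀² = N^{e/2}` (the Fricke constant `u(w_Nτ)u(τ)`) and `C = 4c₀`. -/
theorem pencil_constants :
    (64 : ℤ) = 2 ^ (24 / 4) ∧ (64 : ℤ) ^ 2 = 2 ^ (24 / 2) ∧ (256 : ℤ) = 4 * 64 ∧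
    (27 : ℤ) = 3 ^ (12 / 4) ∧ (27 : ℤ) ^ 2 = 3 ^ (12 / 2) ∧ (108 : ℤ) = 4 * 27 ∧
    (16 : ℤ) = 4 ^ (8 / 4) ∧ (16 : ℤ) ^ 2 = 4 ^ (8 / 2) ∧ (64 : ℤ) = 4 * 16 := by
  norm_num

end Summit.HodgeConjecture.HodgeConjecture.HodgeLocus.Census.FrickeSquare
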